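import Mathlib
import HarnessLib
import Summits.QuantumFields.YangMills.Theses.FradkinShenkerFlow

/-!
# WITHDRAWN lever B (kept for the record) — uniform heat-bath Poincaré ⇒ concentration ⇒ large fields

Typed first lemma `PoincareConcentration` (Aida–Stroock / Bobkov–Ledoux for the Glauber form) and the
composition `lineB` through the route's cruxes 2–3.  Withdrawn by its own cheapest falsifier: the
uniform Poincaré constant C(β) of the single-link heat bath is ≥ c·τ_int(topological charge) ≳ ξ(β)^5
(topological freezing: Del Debbio–Panagopoulos–Vicari 2002, Schaefer–Sommer–Virotta 2011), so the
concentration scale (β² C(β))^{1/4} ≫ ξ(β) and the lever never acts below the correlation length,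
where exponential-mixing concentration is already available.  See NOTES.md `## Barrier notes`.
-/

namespace Summit.QuantumFields.YangMills.Cruxes.ClusteringToYangMills.SketchWithdrawnB

open scoped BigOperators
open MeasureTheory
open Literature.MathematicalPhysics.QuantumFieldTheory
open Summit.QuantumFields.YangMills.Theses

/-- The crux's antecedent, verbatim. -/
def ClusteringHyp : Prop :=
  ∀ (G : Type) [Group G] [TopologicalSpace G] [IsTopologicalGroup G] [CompactSpace G]
    [MeasurableSpace G] [BorelSpace G], IsCompactSimpleLieGroup G →
    ∀ (r : LatticeRep G), ∃ β₀ : ℝ, ∀ β : ℝ, β₀ ≤ β →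
      (∃ m : ℝ, 0 < m ∧ ∀ A B : YMSpecies G, ∃ C : ℝ, ∀ S n : ℕ, n ≤ S →
        |latticeConnectedCorr r.ρ β (2 * S + 1) A.F B.F n| ≤ C * Real.exp (-(m * n)))
/-! ### Card B -/

/-- The uniform heat-bath Poincaré inequality of the torus Wilson measures at `(G, r, β)` with
constant `C` — the conclusion shape of `SusceptibilityToPoincare` / hypothesis of
`PoincareToClustering`, verbatim. -/
def HeatBathPoincare (G : Type) [Group G] [TopologicalSpace G] [IsTopologicalGroup G]
    [CompactSpace G] [MeasurableSpace G] [BorelSpace G] (r : LatticeRep G) (β C : ℝ) : Prop :=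
  ∀ S : ℕ, ∀ F : GaugeConfig 4 (2 * S + 1) G → ℝ, Measurable F → (∃ M : ℝ, ∀ U, |F U| ≤ M) →
    ProbabilityTheory.variance F (wilsonMeasure (d := 4) (L := 2 * S + 1) r.ρ β) ≤
      C * ∑ ℓ : Edge 4 (2 * S + 1), ∫ U, ∫ g, (F U - F (Function.update U ℓ g)) ^ 2
        ∂((haarProbability G).tilted (fun g' => -β * wilsonAction r.ρ (Function.update U ℓ g')))
        ∂(wilsonMeasure (d := 4) (L := 2 * S + 1) r.ρ β)

/-- **Card B, first lemma (Aida–Stroock / Bobkov–Ledoux for the Glauber form).** A heat-bath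
Poincaré inequality with constant `C` gives exponential concentration at scale `√(C Σ_ℓ δ_ℓ²)`
for every functional with per-link oscillations `δ_ℓ`: universal `K`, Laplace-transform form.
(Proof sketch: `(e^{a/2}-e^{b/2})² ≤ ¼(a-b)²(e^a+e^b)`, invariance of `μ` under one-link
heat-bath resampling, and the iteration `Λ(λ) ≤ Λ(λ/2)² / (1 - Cλ²σ²/2)`.) -/
def PoincareConcentration : Prop :=
  ∃ K : ℝ, ∀ (G : Type) [Group G] [TopologicalSpace G] [IsTopologicalGroup G] [CompactSpace G]
    [MeasurableSpace G] [BorelSpace G] (r : LatticeRep G) (β C : ℝ), 0 ≤ β → 0 < C →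
    HeatBathPoincare G r β C →
      ∀ (S : ℕ) (F : GaugeConfig 4 (2 * S + 1) G → ℝ) (δ : Edge 4 (2 * S + 1) → ℝ),
        Measurable F → (∃ M : ℝ, ∀ U, |F U| ≤ M) →
          (∀ U ℓ g, |F U - F (Function.update U ℓ g)| ≤ δ ℓ) →
            ∀ t : ℝ, |t| * Real.sqrt (C * ∑ ℓ, δ ℓ ^ 2) ≤ 1 →
              ∫ U, Real.exp (t * (F U - ∫ V, F V ∂(wilsonMeasure (d := 4) (L := 2 * S + 1) r.ρ β)))
                ∂(wilsonMeasure (d := 4) (L := 2 * S + 1) r.ρ β) ≤ K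

/-- What cruxes 2–3 of the route manufacture on the way to clustering and the crux discards:
a uniform heat-bath Poincaré inequality at every large `β`. -/
def UniformPoincareHyp : Prop :=
  ∀ (G : Type) [Group G] [TopologicalSpace G] [IsTopologicalGroup G] [CompactSpace G]
    [MeasurableSpace G] [BorelSpace G], IsCompactSimpleLieGroup G →
    ∀ (r : LatticeRep G), ∃ β₀ : ℝ, ∀ β : ℝ, β₀ ≤ β → 0 ≤ β ∧ ∃ C : ℝ, HeatBathPoincare G r β C

/-- The open core of line B: the complement WITH the Poincaré resource (large-field suppression
above block scale `(β² C(β))^{1/4}` via `PoincareConcentration`) — weaker than the crux as an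
implication, reached only through the route's own cruxes 2–3. -/
def UPLargeFieldToYangMills : Prop :=
  UniformPoincareHyp → PoincareConcentration → ClusteringHyp → YangMills

/-- **Card B, composition.** -/
theorem lineB (h₂ : FradkinShenkerFlow.SusceptibilityToPoincare)
    (h₃ : FradkinShenkerFlow.FiniteSusceptibilityWeakCoupling)
    (hconc : PoincareConcentration) (hcore : UPLargeFieldToYangMills) :
    FradkinShenkerFlow.ClusteringToYangMills := by
  intro hEC
  refine hcore ?_ hconc hEC
  intro G _ _ _ _ _ _ hG r
  obtain ⟨β₀, hβ₀⟩ := h₃ G hG r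
  refine ⟨max β₀ 0, fun β hβ => ?_⟩
  have h0 : (0 : ℝ) ≤ β := le_trans (le_max_right _ _) hβ
  exact ⟨h0, h₂ G hG r β h0 (hβ₀ β (le_trans (le_max_left _ _) hβ))⟩

end Summit.QuantumFields.YangMills.Cruxes.ClusteringToYangMills.SketchWithdrawnB
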